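import Literature.AlgebraicGeometry.ModuliOfAbelianVarieties.SiegelFamilyHumbertPrimitiveDegree
import Mathlib.Algebra.GCDMonoid.Finset
import HarnessLib

/-!
# Birkenhake–Wilhelm Prop. 4.8 with the degrees: `Z ∈ H_{δ²}(𝔥₂)` iff `X_Z` contains an elliptic curve of
# degree `d` for some divisor `d ∣ δ` (`H_{(δ′)²} ⊆ H_{δ²}` for `δ′ ∣ δ`)

Layer `Literature/AlgebraicGeometry/ModuliOfAbelianVarieties`, namespace `…SiegelModuli`; lane `lit-hodgefound`
(Track 2 foundations library, Layer A4), row **A4-62** (seat skel-4), FILE 5 — sequel of FILE 4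
(`SiegelFamilyHumbertPrimitiveDegree`: a PRIMITIVE relation of invariant `δ²` ⟺ an elliptic curve of degree
exactly `δ`) completing row A4-60 FILE 2 (`SiegelFamilyHumbertSquareInvariant`: `Z ∈ ⋃_{δ>0} H_{δ²}(𝔥₂)` iff `X_Z`
contains an elliptic curve, the degree left open) to the printed Proposition 4.8 with its degrees.

## Source, VERBATIM

Ch. Birkenhake, H. Wilhelm, *Humbert surfaces and the Kummer plane*, Trans. AMS **355** (2003) [BirkenhakeWilhelm2003],
§4 (p. 1830): "Obviously we have `H_Δ ⊆ H_{m²Δ}` for any positive integer `m`. If `Δ` is a square we moreover have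
**Proposition 4.8.** Let `δ` be a positive integer. The Humbert surface `H_{δ²}` is the locus of principally
polarized abelian surfaces `(X, L₀) ∈ 𝒜₂` admitting an isogeny of degree `δ²`,
(12) `(E₁ × E₂, p₁^*𝒪_{E₁}(δ) ⊗ p₂^*𝒪_{E₂}(δ)) → (X, L₀)`. […] *Proof.* […] its connected component `E₁`
containing `0` is an elliptic curve. Using [7] 2.3 we see that `deg L₀|E₁ = δ`. […] Conversely […] the
norm-endomorphism `f = N_{E₁}` […] satisfying `f² − δ′f = 0` with some divisor `δ′` of `δ`. So
`Disc(f) = (δ′)²` and `(X, L₀) ∈ H_{(δ′)²} ⊆ H_{δ²}`. □" ([7] = E. Kani, *Elliptic curves on abelian surfaces*,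
Manuscripta Math. 84 (1994) [Kani1994EllipticCurvesAbelianSurfaces].)

## Statement formalized (`Z ∈ 𝔥₂`, `X_Z = ℂ²/(Z 1₂)ℤ⁴`, `θ_Z = E_Z`; `H_Δ(𝔥₂) = ⋃ {H_q : q ∈ ℤ⁵ ∖ 0, Δ(q) = Δ}` of row A4-59,
which — as B–W's "any equation (∗)" — admits NON-primitive relations)

* §1 `exists_eq_smul_primitive`: every `q ∈ ℤⁿ ∖ 0` is `m · q′` with `m ≠ 0` and `q′` primitive (the content,
  Mathlib's `Finset.extract_gcd`).
* §2 **`humbertLocusOfInvariant_subset_sq_mul`**: `H_Δ(𝔥₂) ⊆ H_{m²Δ}(𝔥₂)` for `m ≠ 0` ("Obviously …"), and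
  `humbertLocusOfInvariant_sq_subset_sq_of_dvd`: `H_{(δ′)²} ⊆ H_{δ²}` for `δ′ ∣ δ`, `δ′ ≠ 0`.
* §3 **PROP. 4.8 WITH THE DEGREES** (`mem_humbertLocusOfInvariant_sq_iff_exists_ellipticCurve_degree_dvd`): for
  `δ > 0`, **`Z ∈ H_{δ²}(𝔥₂)` iff `X_Z` contains an elliptic curve `Y` of degree `deg Y = −E_Z(Φλ′₀, Φλ′₁) = δ′` for
  some divisor `δ′ ∣ δ`, `δ′ > 0`** (⟹: a relation `q = m q′`, `q′` primitive, `m² Δ(q′) = δ²`, so `m ∣ δ` and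
  `Δ(q′) = (δ/m)²`, then FILE 4; ⟸: FILE 4 gives a primitive `q′` with `Δ(q′) = (δ′)²`, and `(δ/δ′) q′` is a
  non-trivial relation of invariant `δ²`); equivalently (`mem_humbertLocusOfInvariant_sq_iff_exists_primitive_dvd`)
  **B–W's `H_{δ²}(𝔥₂)` is the union over `δ′ ∣ δ` of Kani's loci `{q_{(X_Z,θ_Z)} → (δ′)²}`** (primitive relations of
  invariant `(δ′)²`).

## Scope (NOT formalised here)

The isogeny (12) itself and its degree `δ²` (row A4-60 has the isogeny `Y × Y^⊥ → X_Z` without degrees, p09's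
`ComplexTorusComplementarySubtorusDegrees` the complementary degree `deg Y^⊥ = deg Y` in the principal case);
`𝒜₂ = Sp₄(ℤ)\𝔥₂`.

## References

* [BirkenhakeWilhelm2003] Ch. Birkenhake, H. Wilhelm, *Humbert surfaces and the Kummer plane*, Trans. AMS 355 (2003),
  §4 Prop. 4.8 and the sentence before it (p. 1830).
* [Kani1994EllipticCurvesAbelianSurfaces] E. Kani, *Elliptic curves on abelian surfaces*, Manuscripta Math. 84 (1994).
* [Kani2016ModuliJacobiansProductElliptic] E. Kani, *The moduli spaces of Jacobians isomorphic to a product of two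
  elliptic curves*, Collect. Math. 67 (2016) (`H_N = {q_{(A,θ)} → N}`).
-/

noncomputable section

open Module Function Complex Matrix Set Sum

namespace Literature.AlgebraicGeometry.ModuliOfAbelianVarieties

namespace SiegelModuli

open Literature.NumberTheory.Automorphic (siegelUpperHalfSpace)
open Literature.NumberTheory.ModularForms.SiegelUpperHalfSpace
open Literature.Geometry.Kaehler Literature.Geometry.Kaehler.ComplexTorus
open Literature.Analysis.Complex Literature.LinearAlgebra.Alternating

/-! ## §1 The content of an integer vector: `q = m · q′` with `q′` primitive -/

/-- **Every non-zero `q ∈ ℤⁿ` is `m · q′` with `m ≠ 0` and `q′ PRIMITIVE`** (`q′ = k q″ ⟹ k = ±1`): `m` = the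
g.c.d. of the entries (Mathlib's `Finset.extract_gcd`). [cite: BirkenhakeWilhelm2003, §4 proof of Prop. 4.8 ("with some divisor `δ′` of `δ`", p. 1830)] -/
theorem exists_eq_smul_primitive {n : ℕ} {q : Fin n → ℤ} (hq : q ≠ 0) :
    ∃ (m : ℤ) (q' : Fin n → ℤ), m ≠ 0 ∧ q = m • q' ∧
      ∀ (k : ℤ) (q'' : Fin n → ℤ), q' = k • q'' → k = 1 ∨ k = -1 := by
  classical
  have hne : (Finset.univ : Finset (Fin n)).Nonempty := by
    rw [Finset.univ_nonempty_iff]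
    by_contra h
    rw [not_nonempty_iff] at h
    exact hq (funext fun i ↦ (IsEmpty.false i).elim)
  obtain ⟨g, hg, hgcd⟩ := Finset.extract_gcd q hne
  refine ⟨Finset.univ.gcd q, g, ?_, ?_, ?_⟩
  · intro h0
    apply hq
    funext i
    exact (Finset.gcd_eq_zero_iff.1 h0) i (Finset.mem_univ i)
  · funext i
    rw [Pi.smul_apply, smul_eq_mul]
    exact hg i (Finset.mem_univ i)
  · intro k q'' hk
    have hdvd : k ∣ (Finset.univ : Finset (Fin n)).gcd g :=
      Finset.dvd_gcd fun i _ ↦ ⟨q'' i, by rw [hk, Pi.smul_apply, smul_eq_mul]⟩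
    rw [hgcd] at hdvd
    exact Int.isUnit_iff.1 (isUnit_of_dvd_one hdvd)

/-- Casting a multiple: `(m q)_ℂ = m · q_ℂ`. [folklore] -/
private theorem intCast_smul_eq (m : ℤ) (q : Fin 5 → ℤ) :
    (fun i ↦ ((m • q) i : ℂ)) = (m : ℂ) • fun i ↦ (q i : ℂ) := by
  funext i
  rw [Pi.smul_apply, Pi.smul_apply, smul_eq_mul, smul_eq_mul, Int.cast_mul]

/-- A primitive vector is non-zero. [folklore] -/
private theorem ne_zero_of_primitive {q : Fin 5 → ℤ}
    (hprim : ∀ (k : ℤ) (q' : Fin 5 → ℤ), q = k • q' → k = 1 ∨ k = -1) : q ≠ 0 := by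
  rintro rfl
  rcases hprim 0 0 (by rw [zero_smul]) with h | h <;> simp at h

/-! ## §2 `H_Δ ⊆ H_{m²Δ}` -/

/-- **"Obviously we have `H_Δ ⊆ H_{m²Δ}` for any positive integer `m`"**: a relation `q` of invariant `Δ` gives
the relation `mq` of invariant `m²Δ` with the same locus (row A4-59 `humbertLocus_smul`, `humbertInvariant_smul`).
[cite: BirkenhakeWilhelm2003, §4 (sentence before Prop. 4.8, p. 1830)] -/
theorem humbertLocusOfInvariant_subset_sq_mul {m : ℤ} (hm : m ≠ 0) (Δ : ℤ) :
    humbertLocusOfInvariant Δ ⊆ humbertLocusOfInvariant (m ^ 2 * Δ) := by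
  intro Z hZ
  obtain ⟨q, hq0, hqΔ, hZq⟩ := mem_humbertLocusOfInvariant_iff.1 hZ
  refine mem_humbertLocusOfInvariant_iff.2 ⟨m • q, smul_ne_zero hm hq0, by rw [humbertInvariant_smul, hqΔ], ?_⟩
  rw [intCast_smul_eq, humbertLocus_smul (Int.cast_ne_zero.2 hm)]
  exact hZq

/-- `H_{(δ′)²} ⊆ H_{δ²}` for a divisor `δ′ ∣ δ` of a non-zero `δ`. [cite: BirkenhakeWilhelm2003, §4 proof of Prop. 4.8 ("`(X, L₀) ∈ H_{(δ′)²} ⊆ H_{δ²}`", p. 1830)] -/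
theorem humbertLocusOfInvariant_sq_subset_sq_of_dvd {δ' δ : ℤ} (hd : δ' ∣ δ) (hδ : δ ≠ 0) :
    humbertLocusOfInvariant (δ' ^ 2) ⊆ humbertLocusOfInvariant (δ ^ 2) := by
  obtain ⟨k, rfl⟩ := hd
  have hk : k ≠ 0 := by
    rintro rfl
    exact hδ (mul_zero _)
  have h := humbertLocusOfInvariant_subset_sq_mul hk (δ' ^ 2)
  rwa [← mul_pow, mul_comm k] at h

/-! ## §3 Proposition 4.8 with the degrees -/

variable (Z : siegelUpperHalfSpace 2)

/-- **PROPOSITION 4.8 WITH ITS DEGREES: `Z ∈ H_{δ²}(𝔥₂)` iff `X_Z` contains an elliptic curve `Y` whose degree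
`deg Y = (Y·θ_Z) = −E_Z(Φλ′₀, Φλ′₁)` is a (positive) DIVISOR `δ′` of `δ`** (`δ > 0`). (⟹): a non-trivial relation
`q` of invariant `δ²` is `m q′` with `q′` primitive; `m² Δ(q′) = δ²` forces `m ∣ δ` and `Δ(q′) = (δ/m)²`, and FILE 4
turns the primitive `q′` into a curve of degree `|δ/m|`. (⟸): FILE 4 turns the curve into a primitive relation
`q′` of invariant `(δ′)²`; `(δ/δ′)·q′` is a non-trivial relation of invariant `δ²` ("`H_{(δ′)²} ⊆ H_{δ²}`").
[cite: BirkenhakeWilhelm2003, §4 Prop. 4.8 and its proof ("`deg L₀|E₁ = δ`" … "with some divisor `δ′` of `δ` … `(X, L₀) ∈ H_{(δ′)²} ⊆ H_{δ²}`", p. 1830)] [cite: Kani1994EllipticCurvesAbelianSurfaces] -/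
theorem mem_humbertLocusOfInvariant_sq_iff_exists_ellipticCurve_degree_dvd {δ : ℤ} (hδ : 0 < δ) :
    Z ∈ humbertLocusOfInvariant (δ ^ 2) ↔
      ∃ (Y : SubtorusFrame (prinPeriod Z) 2) (δ' : ℤ), 0 < δ' ∧ δ' ∣ δ ∧
        (δ' : ℝ) = -prinForm Z ![latticeVec (prinPeriod Z) (Y.frame 0), latticeVec (prinPeriod Z) (Y.frame 1)] := by
  constructor
  · intro hZ
    obtain ⟨q, hq0, hqΔ, hZq⟩ := mem_humbertLocusOfInvariant_iff.1 hZ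
    obtain ⟨m, q', hm, hqm, hprim⟩ := exists_eq_smul_primitive hq0
    -- `Z ∈ H_{q′}`
    have hZq' : Z ∈ humbertLocus (fun i ↦ (q' i : ℂ)) := by
      rw [hqm, intCast_smul_eq, humbertLocus_smul (Int.cast_ne_zero.2 hm)] at hZq
      exact hZq
    -- `m² Δ(q′) = δ²`, so `m ∣ δ` and `Δ(q′) = (δ/m)²`
    have hΔ' : m ^ 2 * humbertInvariant q' = δ ^ 2 := by rw [← humbertInvariant_smul, ← hqm, hqΔ]
    have hmd : m ∣ δ := (Int.pow_dvd_pow_iff two_ne_zero).1 ⟨humbertInvariant q', hΔ'.symm⟩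
    obtain ⟨d, hd⟩ := hmd
    have hΔd : humbertInvariant q' = d ^ 2 := by
      have h : m ^ 2 * humbertInvariant q' = m ^ 2 * d ^ 2 := by rw [hΔ', hd]; ring
      exact mul_left_cancel₀ (pow_ne_zero 2 hm) h
    have hd0 : d ≠ 0 := by
      rintro rfl
      rw [mul_zero] at hd
      exact hδ.ne' hd
    obtain ⟨Y, hY⟩ :=
      exists_ellipticCurve_degree_eq_of_primitive Z hprim (abs_pos.2 hd0) (by rw [hΔd, sq_abs]) hZq'
    exact ⟨Y, |d|, abs_pos.2 hd0, (abs_dvd d δ).2 ⟨m, by rw [hd, mul_comm]⟩, hY⟩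
  · rintro ⟨Y, δ', hδ', hdδ, hY⟩
    obtain ⟨q', d, hprim, -, hdeg, hΔ, hZq', -⟩ := exists_primitive_relation_of_ellipticCurve Z Y
    have hdd : d = δ' := by
      have h : ((d : ℤ) : ℝ) = δ' := by rw [hdeg, ← hY]
      exact_mod_cast h
    subst hdd
    obtain ⟨k, hk⟩ := hdδ
    have hk0 : k ≠ 0 := by
      rintro rfl
      rw [mul_zero] at hk
      exact hδ.ne' hk
    refine mem_humbertLocusOfInvariant_iff.2 ⟨k • q', smul_ne_zero hk0 (ne_zero_of_primitive hprim), ?_, ?_⟩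
    · rw [humbertInvariant_smul, hΔ, hk]; ring
    · rw [intCast_smul_eq, humbertLocus_smul (Int.cast_ne_zero.2 hk0)]
      exact hZq'

/-- **B–W's `H_{δ²}(𝔥₂)` is the union over the divisors `δ′ ∣ δ` of KANI'S loci `{q_{(X_Z,θ_Z)} → (δ′)²}`**
(primitive relations of invariant `(δ′)²`, FILE 4 = elliptic curves of degree exactly `δ′`).
[cite: BirkenhakeWilhelm2003, §4 Prop. 4.8 (p. 1830)] [cite: Kani2016ModuliJacobiansProductElliptic, (`H_N = {⟨A,θ⟩ : q_{(A,θ)} → N}`, quoted in arXiv:2602.14319 (6.1))] -/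
theorem mem_humbertLocusOfInvariant_sq_iff_exists_primitive_dvd {δ : ℤ} (hδ : 0 < δ) :
    Z ∈ humbertLocusOfInvariant (δ ^ 2) ↔
      ∃ (δ' : ℤ) (q : Fin 5 → ℤ), 0 < δ' ∧ δ' ∣ δ ∧
        (∀ (m : ℤ) (q' : Fin 5 → ℤ), q = m • q' → m = 1 ∨ m = -1) ∧
        humbertInvariant q = δ' ^ 2 ∧ Z ∈ humbertLocus (fun i ↦ (q i : ℂ)) := by
  rw [mem_humbertLocusOfInvariant_sq_iff_exists_ellipticCurve_degree_dvd Z hδ]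
  constructor
  · rintro ⟨Y, δ', hδ', hdδ, hY⟩
    obtain ⟨q, hprim, hΔ, hZq⟩ :=
      (exists_primitive_relation_sq_iff_exists_ellipticCurve_degree_eq Z hδ').2 ⟨Y, hY⟩
    exact ⟨δ', q, hδ', hdδ, hprim, hΔ, hZq⟩
  · rintro ⟨δ', q, hδ', hdδ, hprim, hΔ, hZq⟩
    obtain ⟨Y, hY⟩ := exists_ellipticCurve_degree_eq_of_primitive Z hprim hδ' hΔ hZq
    exact ⟨Y, δ', hδ', hdδ, hY⟩

end SiegelModuli

end Literature.AlgebraicGeometry.ModuliOfAbelianVarieties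

end
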